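import Summits.AtomisticToContinuum.Crystallization.Theorems.FreeSplittingCertificatesStrictSplittingRuleLineTrussAsymptotics

/-!
# `StrictSplittingRule` (stmt-AtomisticToContinuum-12560): asymptotics of the line-truss tension, both orientations

Route `FreeSplittingCertificates`, crux r3 `StrictSplittingRule`, line `registered` (unit b2b-freesplit-B, gen 8).  Corollary of
`…LineTrussAsymptotics.lean` (`h1_tail_asymp`) in the hypothesis style of `…CoreFirstOrderDesignTruss.lean` (`hV`, `hF`, `hτ`):
the tension `τ c s d` of the directed stencil bond `d → d + s` of the landed first-order design is `−½V_LJ(‖V c d‖) + O(‖V c d‖⁻⁷)`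
for BOTH orientations of the bond relative to the root, with a constant depending only on `(a, h)` — so the readout coefficient
`β(b,d,s) = λ_s τ` is `λ_s(r⁻⁶/12 + O(r⁻⁷))`, isotropic at leading order (HOME CERT.md §16 (2); far-lemma architecture FAR-LEMMA-SPEC §7).
Structural bookkeeping ([folklore]); VALUE = a kernel-checked brick of the far lemma — NOT a proof of H12⋆, NOT summit progress.
-/

noncomputable section

namespace Summit.AtomisticToContinuum.Crystallization.Theorems.StrictSplittingRuleBirth

open scoped BigOperators Topology
open Filter Set
open Literature.MathematicalPhysics.StatisticalMechanics
open Summit.AtomisticToContinuum.Crystallization.Theorems.PalmUnimodularRigidity.LayeredLawsSelectHcp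

section Tau

variable {a h : ℝ} {V : Bool → ℤ × ℤ × ℤ → EuclideanSpace ℝ (Fin 3)} {F : Bool → (ℤ × ℤ × ℤ) → (ℤ × ℤ × ℤ) → ℤ → ℝ}
  {τ : Bool → (ℤ × ℤ × ℤ) → (ℤ × ℤ × ℤ) → ℝ}

/-- **Asymptotics of the line-truss tension** (both orientations).  For a stencil direction `s ∈ Y₁` and an index
difference `d ≠ 0`, the tension of the directed bond `d → d + s` of the landed first-order design satisfies
`|τ c s d + ½·V_LJ(‖V c d‖)| ≤ K_τ(a,h)·((‖V c d‖⁻¹)⁷ + (‖V c d‖⁻¹)⁸)` with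
`K_τ = 16K((a+2h)² + (a+2h)/6) + C₁(a+2h)`, `K = 2C₂ + C₁`, `C₁ = ½(1+ρ₀⁻⁶)`, `C₂ = 2 + (7/2)ρ₀⁻⁶`, `ρ₀ = min a h`:
`τ = r⁻⁶/12 + O(r⁻⁷)` uniformly in the direction of `V c d` and in `c, s` — the readout coefficient `β(b,d,s) = λ_s τ` is
ISOTROPIC at leading order (outgoing case: `h1_tail_asymp`; incoming case: the same on the reversed direction plus the node's own
load `|F 0| ≤ C₁‖y_s‖‖V c d‖⁻⁷`, `h1_T_abs_le`). [folklore] -/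
theorem h1_tau_asymp (ha : 0 < a) (hh : 0 < h)
    (hV : ∀ c d, V c d = if c = true then hcpSite a h d else -hcpSite a h (-d))
    (hF : ∀ c s d n, F c s d n =
      ljSqDeriv (‖V c (d + n • s)‖ ^ 2) * inner ℝ (V c (d + n • s)) (hcpSite a h s))
    (hτ : ∀ c s d, τ c s d = if 0 ≤ inner ℝ (V c d) (hcpSite a h s) then ∑' m : ℕ, F c s d ((m : ℤ) + 1)
      else -(F c s d 0 + ∑' m : ℕ, F c s d (-((m : ℤ) + 1))))
    (c : Bool) {s : ℤ × ℤ × ℤ} (hs : s ∈ ({(0, 1, 0), (0, 0, 1), (0, -1, 1), (2, 0, 0)} : Finset (ℤ × ℤ × ℤ)))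
    {d : ℤ × ℤ × ℤ} (hd : d ≠ 0) :
    |τ c s d + 1 / 2 * lennardJones ‖V c d‖| ≤
      (16 * (2 * (2 + 7 / 2 * (((min a h) ^ 2)⁻¹) ^ 3) + 1 / 2 * (1 + (((min a h) ^ 2)⁻¹) ^ 3)) *
            ((a + 2 * h) ^ 2 + (a + 2 * h) / 6) +
          1 / 2 * (1 + (((min a h) ^ 2)⁻¹) ^ 3) * (a + 2 * h)) *
        ((‖V c d‖⁻¹) ^ 7 + (‖V c d‖⁻¹) ^ 8) := by
  set ρ₀ := min a h with hρ₀
  set K : ℝ := 2 * (2 + 7 / 2 * ((ρ₀ ^ 2)⁻¹) ^ 3) + 1 / 2 * (1 + ((ρ₀ ^ 2)⁻¹) ^ 3) with hK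
  set C₁ : ℝ := 1 / 2 * (1 + ((ρ₀ ^ 2)⁻¹) ^ 3) with hC₁
  set e := hcpSite a h s with he_def
  set v := V c d with hv_def
  have hρ : 0 < ρ₀ := lt_min ha hh
  have hs0 : s ≠ 0 := by rintro rfl; exact absurd hs (by decide)
  have he : ρ₀ ≤ ‖e‖ := h1_norm_ge ha hh hs0
  have hepos : 0 < ‖e‖ := hρ.trans_le he
  have heab : ‖e‖ ≤ a + 2 * h := h1_stencil_norm_le ha hh hs
  have hv : ρ₀ ≤ ‖v‖ := h1_V_norm_ge ha hh hV c hd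
  have hvpos : 0 < ‖v‖ := hρ.trans_le hv
  have hK0 : 0 ≤ K := by positivity
  have hC₁0 : 0 ≤ C₁ := by positivity
  have hab : 0 ≤ a + 2 * h := by linarith
  have hline : ∀ n : ℤ, V c (d + n • s) = v + (n : ℝ) • e := h1_V_line hV c (h1_stencil_even hs) d
  have hFn : ∀ n : ℤ, F c s d n = ljSqDeriv (‖v + (n : ℝ) • e‖ ^ 2) * inner ℝ (v + (n : ℝ) • e) e := fun n => by
    rw [hF, hline]
  -- the common weakening of the generic bound
  have hr7 : 0 ≤ (‖v‖⁻¹) ^ 7 := by positivity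
  have hr8 : 0 ≤ (‖v‖⁻¹) ^ 8 := by positivity
  have hweak : 16 * K * ‖e‖ ^ 2 * ((‖v‖⁻¹) ^ 8 + (‖v‖⁻¹) ^ 7 / (6 * ‖e‖)) ≤
      16 * K * ((a + 2 * h) ^ 2 + (a + 2 * h) / 6) * ((‖v‖⁻¹) ^ 7 + (‖v‖⁻¹) ^ 8) := by
    have e1 : 16 * K * ‖e‖ ^ 2 * ((‖v‖⁻¹) ^ 8 + (‖v‖⁻¹) ^ 7 / (6 * ‖e‖)) =
        16 * K * (‖e‖ ^ 2 * (‖v‖⁻¹) ^ 8 + ‖e‖ / 6 * (‖v‖⁻¹) ^ 7) := by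
      field_simp
    rw [e1]
    have h1 : ‖e‖ ^ 2 ≤ (a + 2 * h) ^ 2 := pow_le_pow_left₀ (norm_nonneg _) heab 2
    have h2 : ‖e‖ ^ 2 * (‖v‖⁻¹) ^ 8 ≤ (a + 2 * h) ^ 2 * (‖v‖⁻¹) ^ 8 := mul_le_mul_of_nonneg_right h1 hr8
    have h3 : ‖e‖ / 6 * (‖v‖⁻¹) ^ 7 ≤ (a + 2 * h) / 6 * (‖v‖⁻¹) ^ 7 :=
      mul_le_mul_of_nonneg_right (by linarith) hr7
    have h4 : 0 ≤ (a + 2 * h) ^ 2 * (‖v‖⁻¹) ^ 7 := by positivity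
    have h5 : 0 ≤ (a + 2 * h) / 6 * (‖v‖⁻¹) ^ 8 := by positivity
    have h16K : 0 ≤ 16 * K := by positivity
    have : ‖e‖ ^ 2 * (‖v‖⁻¹) ^ 8 + ‖e‖ / 6 * (‖v‖⁻¹) ^ 7 ≤
        ((a + 2 * h) ^ 2 + (a + 2 * h) / 6) * ((‖v‖⁻¹) ^ 7 + (‖v‖⁻¹) ^ 8) := by nlinarith
    calc 16 * K * (‖e‖ ^ 2 * (‖v‖⁻¹) ^ 8 + ‖e‖ / 6 * (‖v‖⁻¹) ^ 7)
        ≤ 16 * K * (((a + 2 * h) ^ 2 + (a + 2 * h) / 6) * ((‖v‖⁻¹) ^ 7 + (‖v‖⁻¹) ^ 8)) :=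
          mul_le_mul_of_nonneg_left this h16K
      _ = 16 * K * ((a + 2 * h) ^ 2 + (a + 2 * h) / 6) * ((‖v‖⁻¹) ^ 7 + (‖v‖⁻¹) ^ 8) := by ring
  have hX : 0 ≤ C₁ * (a + 2 * h) * ((‖v‖⁻¹) ^ 7 + (‖v‖⁻¹) ^ 8) := by positivity
  rw [hτ]
  split_ifs with hsg
  · -- outgoing: the tail from `m = 1`
    have hcongr : ∑' m : ℕ, F c s d ((m : ℤ) + 1) =
        ∑' m : ℕ, ljSqDeriv (‖v + ((m : ℝ) + 1) • e‖ ^ 2) * inner ℝ (v + ((m : ℝ) + 1) • e) e :=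
      tsum_congr fun m => by rw [hFn]; push_cast; rfl
    rw [hcongr]
    calc |∑' m : ℕ, ljSqDeriv (‖v + ((m : ℝ) + 1) • e‖ ^ 2) * inner ℝ (v + ((m : ℝ) + 1) • e) e +
            1 / 2 * lennardJones ‖v‖|
        ≤ 16 * K * ‖e‖ ^ 2 * ((‖v‖⁻¹) ^ 8 + (‖v‖⁻¹) ^ 7 / (6 * ‖e‖)) := h1_tail_asymp hρ hv he hsg
      _ ≤ 16 * K * ((a + 2 * h) ^ 2 + (a + 2 * h) / 6) * ((‖v‖⁻¹) ^ 7 + (‖v‖⁻¹) ^ 8) := hweak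
      _ ≤ (16 * K * ((a + 2 * h) ^ 2 + (a + 2 * h) / 6) + C₁ * (a + 2 * h)) *
            ((‖v‖⁻¹) ^ 7 + (‖v‖⁻¹) ^ 8) := by rw [add_mul]; linarith [hX]
  · -- incoming: reverse the direction, `e' = -e`, and add the node's own load `F 0`
    have hsg' : inner ℝ v e < 0 := not_le.mp hsg
    have hve' : 0 ≤ inner ℝ v (-e) := by rw [inner_neg_right]; linarith
    have he' : ρ₀ ≤ ‖-e‖ := by rwa [norm_neg]
    have hG : ∀ m : ℕ, F c s d (-((m : ℤ) + 1)) =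
        -(ljSqDeriv (‖v + ((m : ℝ) + 1) • (-e)‖ ^ 2) * inner ℝ (v + ((m : ℝ) + 1) • (-e)) (-e)) := by
      intro m
      rw [hFn, inner_neg_right]
      push_cast
      rw [show v + (-((m : ℝ) + 1)) • e = v + ((m : ℝ) + 1) • (-e) by rw [smul_neg, neg_smul]]
      ring
    have hsumG : ∑' m : ℕ, F c s d (-((m : ℤ) + 1)) =
        -∑' m : ℕ, ljSqDeriv (‖v + ((m : ℝ) + 1) • (-e)‖ ^ 2) * inner ℝ (v + ((m : ℝ) + 1) • (-e)) (-e) := by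
      rw [← tsum_neg]; exact tsum_congr hG
    have hF0 : F c s d 0 = ljSqDeriv (‖v‖ ^ 2) * inner ℝ v e := by
      rw [hFn]; simp
    have hF0le : |F c s d 0| ≤ C₁ * ‖e‖ * (‖v‖⁻¹) ^ 7 := by rw [hF0]; exact h1_T_abs_le hρ hv e
    have hasy := h1_tail_asymp hρ hv he' hve'
    rw [norm_neg] at hasy
    rw [hsumG]
    have e2 : -(F c s d 0 + -∑' m : ℕ, ljSqDeriv (‖v + ((m : ℝ) + 1) • (-e)‖ ^ 2) *
          inner ℝ (v + ((m : ℝ) + 1) • (-e)) (-e)) + 1 / 2 * lennardJones ‖v‖ =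
        (∑' m : ℕ, ljSqDeriv (‖v + ((m : ℝ) + 1) • (-e)‖ ^ 2) * inner ℝ (v + ((m : ℝ) + 1) • (-e)) (-e) +
          1 / 2 * lennardJones ‖v‖) + -F c s d 0 := by ring
    rw [e2]
    have h2 : C₁ * ‖e‖ * (‖v‖⁻¹) ^ 7 ≤ C₁ * (a + 2 * h) * ((‖v‖⁻¹) ^ 7 + (‖v‖⁻¹) ^ 8) := by
      have h21 : C₁ * ‖e‖ * (‖v‖⁻¹) ^ 7 ≤ C₁ * (a + 2 * h) * (‖v‖⁻¹) ^ 7 :=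
        mul_le_mul_of_nonneg_right (mul_le_mul_of_nonneg_left heab hC₁0) hr7
      have h22 : C₁ * (a + 2 * h) * (‖v‖⁻¹) ^ 7 ≤ C₁ * (a + 2 * h) * ((‖v‖⁻¹) ^ 7 + (‖v‖⁻¹) ^ 8) :=
        mul_le_mul_of_nonneg_left (le_add_of_nonneg_right hr8) (mul_nonneg hC₁0 hab)
      exact h21.trans h22
    calc |(∑' m : ℕ, ljSqDeriv (‖v + ((m : ℝ) + 1) • (-e)‖ ^ 2) * inner ℝ (v + ((m : ℝ) + 1) • (-e)) (-e) +
              1 / 2 * lennardJones ‖v‖) + -F c s d 0|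
        ≤ |∑' m : ℕ, ljSqDeriv (‖v + ((m : ℝ) + 1) • (-e)‖ ^ 2) * inner ℝ (v + ((m : ℝ) + 1) • (-e)) (-e) +
              1 / 2 * lennardJones ‖v‖| + |-F c s d 0| := abs_add_le _ _
      _ ≤ 16 * K * ‖e‖ ^ 2 * ((‖v‖⁻¹) ^ 8 + (‖v‖⁻¹) ^ 7 / (6 * ‖e‖)) + C₁ * ‖e‖ * (‖v‖⁻¹) ^ 7 := by
          rw [abs_neg]; exact add_le_add hasy hF0le
      _ ≤ 16 * K * ((a + 2 * h) ^ 2 + (a + 2 * h) / 6) * ((‖v‖⁻¹) ^ 7 + (‖v‖⁻¹) ^ 8) +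
            C₁ * (a + 2 * h) * ((‖v‖⁻¹) ^ 7 + (‖v‖⁻¹) ^ 8) := add_le_add hweak h2
      _ = (16 * K * ((a + 2 * h) ^ 2 + (a + 2 * h) / 6) + C₁ * (a + 2 * h)) *
            ((‖v‖⁻¹) ^ 7 + (‖v‖⁻¹) ^ 8) := by ring

end Tau

end Summit.AtomisticToContinuum.Crystallization.Theorems.StrictSplittingRuleBirth

end
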